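import Summits.QuantumFields.YangMills.Theorems.EguchiKawaiDirectionLadderWordSplitting
import HarnessLib

/-!
# The merging formula: the carré du champ of two Eguchi–Kawai words and the interaction side of the
# loop equation for an arbitrary reduced contour

HONEST FRAMING. Glue for LINE 8 (`route-QuantumFields-EguchiKawaiDirectionLadder`, barrier-ledger line
onto `Literature.Barriers.QuantumFields.EguchiKawaiBreakdown`), lane «loop equations of the single-site
model» (Makeenko 2023 §12.4, §14.3 (14.50)): the RIGHT-HAND (interaction) side. The loop equation
`∫ w (Δ Re tr W_l + Γ(-N² b S_R, Re tr W_l)) = 0` (`ek_word_loopEquation`) has its kinetic side expanded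
by the splitting formula (`EguchiKawaiDirectionLadderWordSplitting`); here the interaction side is
expanded by the `𝔰𝔲(N)` MERGING identity `Σ_α tr(Y_α A) tr(Y_α B) = -tr(A B) + tr(A) tr(B)/N`:

* `ekLoopDeriv e g l P M` — the **loop derivative** of the word at the link `e` (a matrix; recursion
  along `l`: each letter `(e,+)` contributes the rotated word `W_rest M P g_e`, each `(e,-)` contributes
  `-g_eᴴ W_rest M P`), with `trace_mul_ekWordJet1_lk : tr(P W₁^{(e,Y)}(l) M) = tr(Y · ekLoopDeriv e g l P M)`
  for every direction `Y`;
* `algD_reTr_ekWordMat` — `D_V Re tr W_l (g) = Re tr W₁(l)(0)`;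
* `Gam_reTr_ekWordMat` — **`Γ(Re tr W_l, Re tr W_{l'})(g) = Σ_e ekMergeTerm (A_e) (B_e)`**,
  `A_e, B_e` the loop derivatives of `l, l'` at `e`, where
  `ekMergeTerm A B = ½ Re(-tr(A B) + tr(A) tr(B)/N + tr(A Bᴴ) - tr(A) tr(Bᴴ)/N)`
  (MERGED words `tr(A B)` — the joining of the two contours at a common link — and `1/N`-corrections);
* `Gam_ekPot_reTr_ekWordMat` — the interaction term of the loop equation:
  `Γ(-N² b S_R, Re tr W_l) = (N b/2) Σ_{κ≠λ} Γ(Re tr P_{κλ}, Re tr W_l)`, `P_{κλ}` the reduced plaquette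
  word `[(λ,-),(κ,-),(λ,+),(κ,+)]` — Makeenko's plaquette-insertion terms;
* `ek_word_loopEquation_explicit` — the finite-`N` loop equation of an arbitrary reduced contour with
  BOTH sides in closed recursive form (every `d`, `N ≥ 1`, `b`, `l`).

Nothing here concerns the Yang–Mills mass gap / the summit Statement `YangMills`.

References: Y. Makeenko, *Methods of Contemporary Gauge Theory* (2023) §12.4 (loop equations,
area/loop derivative), §14.3 (14.50); Yu. Makeenko, A. Migdal, Phys. Lett. B 88 (1979) 135;
S. Chatterjee, CMP 366 (2019) 203, Theorem 8.1 (merger and deformation terms).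
-/

noncomputable section

open scoped Matrix ComplexConjugate BigOperators Matrix.Norms.Frobenius ContDiff Topology
open Matrix Complex Finset MeasureTheory Filter
open Summit.Ventures.YMGap.LatticeBakryEmery
open Summit.Ventures.YMGap
open Summit.Ventures.YMGap.HessianSharp (hasDerivAt_reTrace)
open Literature.MathematicalPhysics.QuantumFieldTheory.SUNBakryEmery (frame FrameIdx frame_conjTranspose
  sum_trace_mul_smul_frame)
open Literature.Barriers.QuantumFields (EKConfigSU ekHaarSU inclSU ekWeight)

namespace Summit.QuantumFields.YangMills.Theorems.EguchiKawaiDirectionLadder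

variable {d N : ℕ}

/-! ## The first derivative of a word and the loop derivative -/

/-- **`D_V Re tr W_l (g) = Re tr W₁(l)(0)`** for `g ∈ SU(N)^d`, `V ∈ 𝔲(N)^d`. -/
theorem algD_reTr_ekWordMat (g : PSU (Fin d) N) (V : Cfg (Fin d) N) (hV : ∀ e, (V e)ᴴ = -V e)
    (l : List (Fin d × Bool)) :
    algD V (fun Q : Cfg (Fin d) N => (ekWordMat l Q).trace.re) (emb g) = (ekWordJet1 g V l 0).trace.re := by
  have h1 := hasDerivAt_comp_mul_exp (contDiff_reTr_ekWordMat (d := d) (N := N) l) (emb g) V 0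
  rw [zero_smul, NormedSpace.exp_zero, mul_one] at h1
  have h2 : HasDerivAt (fun s : ℝ => (ekWordMat l (emb g * NormedSpace.exp (s • V))).trace.re)
      (ekWordJet1 g V l 0).trace.re 0 := by
    have := hasDerivAt_reTrace (hasDerivAt_ekWordJet0 g V l 0)
    refine this.congr_of_eventuallyEq (Eventually.of_forall fun s => ?_)
    simp only [ekWordMat_flow g V hV]
  exact h1.unique h2

/-- **The loop derivative of a word at the link `e`**: the matrix `R` with
`tr(P W₁^{(e,Y)}(l) M) = tr(Y R)` for every direction `Y` in the link `e` — each letter `(e,+)` of `l`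
contributes the rotated word `W_rest M P g_e` (insertion of `Y` right after `g_e`), each `(e,-)`
contributes `-g_eᴴ W_rest M P` (insertion right before `g_eᴴ`). -/
def ekLoopDeriv (e : Fin d) (g : PSU (Fin d) N) :
    List (Fin d × Bool) → Matrix (Fin N) (Fin N) ℂ → Matrix (Fin N) (Fin N) ℂ → Matrix (Fin N) (Fin N) ℂ
  | [], _, _ => 0
  | a :: l, P, M =>
      (if a.1 = e then
          (if a.2 then ekWordMat l (emb g) * M * P * (g a.1 : Matrix (Fin N) (Fin N) ℂ)
            else -((g a.1 : Matrix (Fin N) (Fin N) ℂ)ᴴ * ekWordMat l (emb g) * M * P))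
        else 0)
        + ekLoopDeriv e g l (P * ekLetterMat (emb g) a) M

/-- The loop derivative of the empty word vanishes. -/
@[simp] theorem ekLoopDeriv_nil (e : Fin d) (g : PSU (Fin d) N) (P M : Matrix (Fin N) (Fin N) ℂ) :
    ekLoopDeriv e g [] P M = 0 := rfl

/-- Unfolding the loop-derivative recursion. -/
theorem ekLoopDeriv_cons (e : Fin d) (g : PSU (Fin d) N) (a : Fin d × Bool) (l : List (Fin d × Bool))
    (P M : Matrix (Fin N) (Fin N) ℂ) :
    ekLoopDeriv e g (a :: l) P M =
      (if a.1 = e then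
          (if a.2 then ekWordMat l (emb g) * M * P * (g a.1 : Matrix (Fin N) (Fin N) ℂ)
            else -((g a.1 : Matrix (Fin N) (Fin N) ℂ)ᴴ * ekWordMat l (emb g) * M * P))
        else 0)
        + ekLoopDeriv e g l (P * ekLetterMat (emb g) a) M := rfl

/-- The first jet of a letter in the direction `single_e Y`. -/
theorem ekLetterJet_one_lk (g : PSU (Fin d) N) (e : Fin d) (Y : Matrix (Fin N) (Fin N) ℂ) (a : Fin d × Bool) :
    ekLetterJet g (lk e Y) 1 a 0 =
      if a.1 = e then
        (if a.2 then (g a.1 : Matrix (Fin N) (Fin N) ℂ) * Y else -Y * (g a.1 : Matrix (Fin N) (Fin N) ℂ)ᴴ)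
      else 0 := by
  rw [ekLetterJet_one_zero]
  simp only [lk]
  by_cases h : a.1 = e
  · simp [h]
  · simp [h]

/-- **`tr(P W₁^{(e,Y)}(l) M) = tr(Y · ekLoopDeriv e g l P M)`** for every direction `Y` in the link `e`. -/
theorem trace_mul_ekWordJet1_lk (e : Fin d) (g : PSU (Fin d) N) (Y : Matrix (Fin N) (Fin N) ℂ)
    (l : List (Fin d × Bool)) (P M : Matrix (Fin N) (Fin N) ℂ) :
    (P * ekWordJet1 g (lk e Y) l 0 * M).trace = (Y * ekLoopDeriv e g l P M).trace := by
  induction l generalizing P with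
  | nil => simp
  | cons a l ih =>
    rw [ekWordJet1_cons, ekLoopDeriv_cons, ekWordJet0_zero, ekLetterJet_zero_zero, ekLetterJet_one_lk,
      Matrix.mul_add, Matrix.add_mul, Matrix.trace_add, Matrix.mul_add, Matrix.trace_add,
      ← Matrix.mul_assoc P (ekLetterMat (emb g) a), ih (P * ekLetterMat (emb g) a)]
    congr 1
    by_cases he : a.1 = e
    · simp only [he, if_true]
      by_cases h2 : a.2 = true
      · simp only [h2, if_true]
        -- `tr(P (g Y W) M) = tr(Y (W M P g))`
        rw [show P * ((g e : Matrix (Fin N) (Fin N) ℂ) * Y * ekWordMat l (emb g)) * M =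
            (P * (g e : Matrix (Fin N) (Fin N) ℂ)) * (Y * (ekWordMat l (emb g) * M)) by simp only [Matrix.mul_assoc],
          Matrix.trace_mul_comm]
        simp only [Matrix.mul_assoc]
      · simp only [h2, if_false, Bool.false_eq_true]
        rw [show P * (-Y * (g e : Matrix (Fin N) (Fin N) ℂ)ᴴ * ekWordMat l (emb g)) * M =
            -(P * (Y * ((g e : Matrix (Fin N) (Fin N) ℂ)ᴴ * ekWordMat l (emb g) * M))) by
              simp only [Matrix.neg_mul, Matrix.mul_neg, Matrix.mul_assoc],
          Matrix.trace_neg, Matrix.trace_mul_comm, Matrix.mul_neg, Matrix.trace_neg]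
        simp only [Matrix.mul_assoc]
    · simp only [he, if_false, Matrix.mul_zero, Matrix.zero_mul, Matrix.trace_zero]

/-! ## The merging identity and the carré du champ of two words -/

/-- **The merging identity** `Σ_α tr(Y_α A) tr(Y_α B) = -tr(A B) + tr(A) tr(B)/N` (completeness of the
Parseval frame of `𝔰𝔲(N)`). -/
theorem sum_trace_frame_mul_trace_frame (hN : N ≠ 0) (A B : Matrix (Fin N) (Fin N) ℂ) :
    ∑ α : FrameIdx N, (frame α * A).trace * (frame α * B).trace = -(A * B).trace + A.trace * B.trace / N := by
  have h : ∑ α : FrameIdx N, (frame α * A).trace * (frame α * B).trace =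
      ((∑ α : FrameIdx N, (frame α * A).trace • frame α) * B).trace := by
    rw [Finset.sum_mul, Matrix.trace_sum]
    refine Finset.sum_congr rfl fun α _ => ?_
    rw [Matrix.smul_mul, Matrix.trace_smul, smul_eq_mul]
  rw [h, sum_trace_mul_smul_frame hN, Matrix.add_mul, Matrix.trace_add, Matrix.neg_mul, Matrix.trace_neg,
    Matrix.smul_mul, Matrix.one_mul, Matrix.trace_smul, smul_eq_mul]
  ring

/-- The merged-word term of two loop derivatives:
`½ Re(-tr(A B) + tr(A) tr(B)/N + tr(A Bᴴ) - tr(A) tr(Bᴴ)/N)`. -/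
def ekMergeTerm (N : ℕ) (A B : Matrix (Fin N) (Fin N) ℂ) : ℝ :=
  (1 / 2 : ℝ) * (-(A * B).trace + A.trace * B.trace / N + (A * Bᴴ).trace - A.trace * Bᴴ.trace / N).re

/-- For skew-Hermitian `Y`: `conj tr(Y B) = -tr(Y Bᴴ)`. -/
theorem conj_trace_skew_mul {Y : Matrix (Fin N) (Fin N) ℂ} (hY : Yᴴ = -Y) (B : Matrix (Fin N) (Fin N) ℂ) :
    conj (Y * B).trace = -(Y * Bᴴ).trace := by
  rw [← Complex.star_def, ← Matrix.trace_conjTranspose, Matrix.conjTranspose_mul, hY, Matrix.mul_neg,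
    Matrix.trace_neg, Matrix.trace_mul_comm]

/-- **`Σ_α Re tr(Y_α A) · Re tr(Y_α B) = ekMergeTerm A B`** (real polarisation of the merging identity). -/
theorem sum_re_trace_frame_mul (hN : N ≠ 0) (A B : Matrix (Fin N) (Fin N) ℂ) :
    ∑ α : FrameIdx N, (frame α * A).trace.re * (frame α * B).trace.re = ekMergeTerm N A B := by
  have hre : ∀ α : FrameIdx N, (frame α * A).trace.re * (frame α * B).trace.re =
      (1 / 2 : ℝ) * ((frame α * A).trace * (frame α * B).trace - (frame α * A).trace * (frame α * Bᴴ).trace).re := by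
    intro α
    have hc := conj_trace_skew_mul (frame_conjTranspose α) B
    -- `Re x Re y = ½ Re (x y + x conj y)` and `conj y = -tr(Y Bᴴ)`
    have key : ((frame α * A).trace.re : ℝ) * (frame α * B).trace.re =
        (1 / 2 : ℝ) * ((frame α * A).trace * (frame α * B).trace
          + (frame α * A).trace * conj (frame α * B).trace).re := by
      simp only [Complex.add_re, Complex.mul_re, Complex.conj_re, Complex.conj_im]
      ring
    rw [key, hc, mul_neg, ← sub_eq_add_neg]
  simp_rw [hre]
  rw [← Finset.mul_sum, ← Complex.re_sum, Finset.sum_sub_distrib, sum_trace_frame_mul_trace_frame hN,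
    sum_trace_frame_mul_trace_frame hN]
  unfold ekMergeTerm
  congr 1
  congr 1
  ring

/-- **The carré du champ of two words**: `Γ(Re tr W_l, Re tr W_{l'})(g) = Σ_e ekMergeTerm (A_e) (B_e)`
with `A_e = ekLoopDeriv e g l 1 1`, `B_e = ekLoopDeriv e g l' 1 1` the loop derivatives at the link `e`. -/
theorem Gam_reTr_ekWordMat (hN : N ≠ 0) (g : PSU (Fin d) N) (l l' : List (Fin d × Bool)) :
    Gam (fun Q : Cfg (Fin d) N => (ekWordMat l Q).trace.re) (fun Q => (ekWordMat l' Q).trace.re) (emb g) =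
      ∑ e : Fin d, ekMergeTerm N (ekLoopDeriv e g l 1 1) (ekLoopDeriv e g l' 1 1) := by
  unfold Gam
  rw [Fintype.sum_prod_type]
  refine Finset.sum_congr rfl fun e _ => ?_
  have h : ∀ α : FrameIdx N, ∀ l₀ : List (Fin d × Bool),
      algD (bframe (e, α)) (fun Q : Cfg (Fin d) N => (ekWordMat l₀ Q).trace.re) (emb g) =
        (frame α * ekLoopDeriv e g l₀ 1 1).trace.re := by
    intro α l₀
    rw [algD_reTr_ekWordMat g _ (bframe_conjTranspose (e, α)) l₀, show bframe ((e, α) : BIdx (Fin d) N) =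
      lk e (frame α) from rfl, ← trace_mul_ekWordJet1_lk e g (frame α) l₀ 1 1, Matrix.one_mul, Matrix.mul_one]
  simp_rw [h]
  exact sum_re_trace_frame_mul hN _ _

/-! ## The interaction side of the loop equation -/

/-- The reduced plaquette as a four-letter word: `Re tr(Q_λᴴ Q_κᴴ Q_λ Q_κ) = Re tr W_{[(λ,-),(κ,-),(λ,+),(κ,+)]}`. -/
theorem ekPlaq_eq_reTr_ekWordMat (κ l : Fin d) :
    ekPlaq (N := N) κ l = fun Q : Cfg (Fin d) N => (ekWordMat [(l, false), (κ, false), (l, true), (κ, true)] Q).trace.re := by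
  funext Q
  simp only [ekPlaq, ekWordMat_cons, ekWordMat_nil, ekLetterMat, Matrix.mul_one, Matrix.mul_assoc, if_true,
    if_false, Bool.false_eq_true]

/-- `D_V (-N² b S_R) = (N b / 2) Σ_{κ≠λ} D_V Re tr P_{κλ}` (first derivative of the potential). -/
theorem algD_ekPot (b : ℝ) (V : Cfg (Fin d) N) (Q : Cfg (Fin d) N) :
    algD V (ekPot d N b) Q =
      -((N : ℝ) ^ 2 * b) * ∑ κ : Fin d, ∑ l : Fin d, (if κ = l then 0 else -(1 / (2 * (N : ℝ))) * algD V (ekPlaq κ l) Q) := by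
  have hT : ∀ κ l : Fin d, ContDiff ℝ ∞ (ekTerm (N := N) κ l) := fun κ l => contDiff_ekTerm κ l
  have hS : ContDiff ℝ ∞ fun Q : Cfg (Fin d) N => ∑ κ : Fin d, ∑ l : Fin d, ekTerm κ l Q :=
    ContDiff.sum fun κ _ => ContDiff.sum fun l _ => hT κ l
  rw [ekPot_eq, algD_const_mul hS, algD_sum_sum hT]
  simp only [algD_ekTerm]

/-- **The interaction term of the loop equation**: `Γ(-N² b S_R, Re tr W_l)(g) = (N b / 2) Σ_{κ≠λ} Γ(Re tr P_{κλ}, Re tr W_l)(g)`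
— Makeenko's plaquette-insertion (deformation) terms, each given by `Gam_reTr_ekWordMat`. -/
theorem Gam_ekPot_reTr_ekWordMat (hN : N ≠ 0) (b : ℝ) (g : PSU (Fin d) N) (l₀ : List (Fin d × Bool)) :
    Gam (ekPot d N b) (fun Q : Cfg (Fin d) N => (ekWordMat l₀ Q).trace.re) (emb g) =
      (N : ℝ) * b / 2 * ∑ κ : Fin d, ∑ l : Fin d, (if κ = l then 0 else
        Gam (fun Q : Cfg (Fin d) N => (ekWordMat [(l, false), (κ, false), (l, true), (κ, true)] Q).trace.re)
          (fun Q => (ekWordMat l₀ Q).trace.re) (emb g)) := by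
  have hN' : (N : ℝ) ≠ 0 := by exact_mod_cast hN
  have hs : -((N : ℝ) ^ 2 * b) * (-(1 / (2 * (N : ℝ)))) = (N : ℝ) * b / 2 := by
    rw [show -((N : ℝ) ^ 2 * b) * (-(1 / (2 * (N : ℝ)))) = ((N : ℝ) * (N : ℝ)⁻¹) * ((N : ℝ) * b / 2) by ring,
      mul_inv_cancel₀ hN', one_mul]
  set G : Cfg (Fin d) N → ℝ := fun Q => (ekWordMat l₀ Q).trace.re with hG
  -- termwise form of both sides
  have lhs : Gam (ekPot d N b) G (emb g) = ∑ a : BIdx (Fin d) N, ∑ κ : Fin d, ∑ l : Fin d,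
      (if κ = l then 0 else (N : ℝ) * b / 2 * (algD (bframe a) (ekPlaq κ l) (emb g) * algD (bframe a) G (emb g))) := by
    simp only [Gam]
    refine Finset.sum_congr rfl fun a _ => ?_
    rw [algD_ekPot, Finset.mul_sum, Finset.sum_mul]
    refine Finset.sum_congr rfl fun κ _ => ?_
    rw [Finset.mul_sum, Finset.sum_mul]
    refine Finset.sum_congr rfl fun l _ => ?_
    by_cases h : κ = l
    · simp [h]
    · simp only [h, if_false]
      rw [← hs]
      ring
  have rhs : (N : ℝ) * b / 2 * ∑ κ : Fin d, ∑ l : Fin d, (if κ = l then 0 else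
        Gam (fun Q : Cfg (Fin d) N => (ekWordMat [(l, false), (κ, false), (l, true), (κ, true)] Q).trace.re) G (emb g)) =
      ∑ κ : Fin d, ∑ l : Fin d, ∑ a : BIdx (Fin d) N,
        (if κ = l then 0 else (N : ℝ) * b / 2 * (algD (bframe a) (ekPlaq κ l) (emb g) * algD (bframe a) G (emb g))) := by
    rw [Finset.mul_sum]
    refine Finset.sum_congr rfl fun κ _ => ?_
    rw [Finset.mul_sum]
    refine Finset.sum_congr rfl fun l _ => ?_
    by_cases h : κ = l
    · simp [h]
    · simp only [h, if_false, Gam, Finset.mul_sum, ekPlaq_eq_reTr_ekWordMat]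
  rw [lhs, rhs, Finset.sum_comm]
  refine Finset.sum_congr rfl fun κ _ => ?_
  rw [Finset.sum_comm]

/-- **The Eguchi–Kawai loop equation of an arbitrary reduced contour, fully explicit at finite `N`**:
`∫ w · (Σ_e Re ekLapSum e V l 1 + (N b/2) Σ_{κ≠λ} Σ_e ekMergeTerm (R_e(P_{κλ})) (R_e(l))) = 0`
(`w = e^{-N² b S_R}`; every `d`, `N ≥ 1`, `b`, `l`) — kinetic side: Casimir + SPLITTING terms (open/closed
sub-contours, (14.51)); interaction side: MERGING of the contour with the reduced plaquettes at common
links (Makeenko (14.50)). -/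
theorem ek_word_loopEquation_explicit (hN : N ≠ 0) (b : ℝ) (l₀ : List (Fin d × Bool)) :
    ∫ V : EKConfigSU d N, ekWeight N b (inclSU V) *
        ((∑ e : Fin d, (ekLapSum e V l₀ 1).re)
          + (N : ℝ) * b / 2 * ∑ κ : Fin d, ∑ l : Fin d, (if κ = l then 0 else
              ∑ e : Fin d, ekMergeTerm N (ekLoopDeriv e V [(l, false), (κ, false), (l, true), (κ, true)] 1 1)
                (ekLoopDeriv e V l₀ 1 1))) ∂(ekHaarSU d N) = 0 := by
  have h := ek_word_loopEquation hN b l₀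
  have hcongr : (∫ V : EKConfigSU d N, ekWeight N b (inclSU V) *
        ((∑ e : Fin d, (ekLapSum e V l₀ 1).re)
          + (N : ℝ) * b / 2 * ∑ κ : Fin d, ∑ l : Fin d, (if κ = l then 0 else
              ∑ e : Fin d, ekMergeTerm N (ekLoopDeriv e V [(l, false), (κ, false), (l, true), (κ, true)] 1 1)
                (ekLoopDeriv e V l₀ 1 1))) ∂(ekHaarSU d N)) =
      ∫ V : EKConfigSU d N, ekWeight N b (inclSU V) *
        ((∑ e : Fin d, (ekLapSum e V l₀ 1).re)
          + Gam (ekPot d N b) (fun Q : Cfg (Fin d) N => (ekWordMat l₀ Q).trace.re) (emb V)) ∂(ekHaarSU d N) := by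
    refine integral_congr_ae (ae_of_all _ fun V => ?_)
    simp only [Gam_ekPot_reTr_ekWordMat hN b V l₀, Gam_reTr_ekWordMat hN V]
  rw [hcongr]
  exact h

end Summit.QuantumFields.YangMills.Theorems.EguchiKawaiDirectionLadder
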